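import Summits.Ventures.Crystal3D.Theorems.StickyWulffConstantGenericWallFloorBarlowOrientedGlueOneSidedAt
import Summits.Ventures.Crystal3D.Theorems.StickyWulffConstantGenericWallFloorBarlowOneSidedTop
import HarnessLib

/-!
# F4 glue for ONE up-presented TOP plate (walkers toward `−e₃`) with a CHOSEN reference upper slot `v`, clause (ii) alone
# (crux `GenericWallFloor`, stmt-Ventures-19480, line `WallLedgerG`; lane T row (e) `stub_residualFaulted`, cf-p1 (lxxxviii)/(xc)/(xciii), K1a
# «chosen family», DOWN half, of HOME/wall-p2-g10/FAULTED-LEDGER-MEMO.md)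

HONEST FRAMING. Venture `Summits/Ventures/Crystal3D` (cell `crystal3d-full`), helper `--supports` the crux `GenericWallFloor`
(stmt-Ventures-19480) of `route-Ventures-StickyWulffConstant`, registered line `WallLedgerG`.  Rung credit only; F-C1 not moved; NOT the
stub.  Inputs BY NAME: E1 (`ExactOnly`), `DoubleStarCoaxialAt` / `CapPairCoaxial`.

The mirror companion of `barlow_hlines_oriented_oneSided_at` (…BarlowOrientedGlueOneSidedAt): the TOP plate `(L₂, s₂, σ₂)` presented with its
layer index increasing along `−e₃`, ANY of its three reference upper slots `v` that is steep toward `−e₃`, machine steps `v` on Δ-bilayers and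
the `−e₃`-best capper on ∇-bilayers, `δ = 1/4`, hypothesis `hapart₂` = clause (ii) of `FramesApart` for `chainFrames (−e₃) L₂ v` only; the
bottom plate is the passive clamped sample.  Count = `barlow_lineCount_le_payers_oneSided_top` (…BarlowOneSidedTop).
* **`barlow_hlines_oriented_oneSided_top_at`** — `∃ step₂, (∀ k, IsUpBond L₂ σ₂ (−e₃) k (step₂ k)) ∧ (Δ: step₂ k = v) ∧ (∇: rise = bilayerRise) ∧
  ∀ cell, ∃ m ≥ 0, ∃ T₂ ⊇ {window lines in [h+R₀+3, h+R₀+4] at lateral ≤ ρ − m}, #T₂ + 18mρ ≤ Σ_PAY(12−deg) + (318+192R₀)(1+h)ρ`.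
WHAT THIS IS NOT: not the T-side cell inequality; F-C1 not moved.
-/

noncomputable section

namespace Summit.Ventures.Crystal3D.Theorems

open Finset
open Literature.MathematicalPhysics.StatisticalMechanics
open Summit.Ventures.Crystal3D.Cruxes.TextureLiminf.TexShadow (stacking cyl upSlot₁ upSlot₂ upSlot₃ bilayerRise)
open scoped InnerProductSpace

/-- **F4 glue for ONE up-presented TOP plate with a CHOSEN steep reference upper slot `v`, clause (ii) only.** -/
theorem barlow_hlines_oriented_oneSided_top_at
    {sE : EuclideanSpace ℝ (Fin 3)} (hsE : sE ∈ fccSlots) (hcert : ExactOnly 0 (fccSlots.filter fun w => 0 < ⟪w, sE⟫_ℝ))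
    (hDS : ∀ F₁ F₂ : EuclideanSpace ℝ (Fin 3) ≃ₗᵢ[ℝ] EuclideanSpace ℝ (Fin 3), DoubleStarCoaxialAt F₁ F₂) (hCP : CapPairCoaxial)
    {σ₁ σ₂ : ℤ → ℤ} (hσ₁ : IsHaggSeq σ₁) (hσ₂ : IsHaggSeq σ₂)
    (L₁ L₂ : EuclideanSpace ℝ (Fin 3) ≃ₗᵢ[ℝ] EuclideanSpace ℝ (Fin 3)) (s₁ s₂ : EuclideanSpace ℝ (Fin 3))
    (hax₂ : 0 ≤ (L₂.symm (-EuclideanSpace.single (2 : Fin 3) (1 : ℝ))) 2)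
    {v : EuclideanSpace ℝ (Fin 3)} (hv : v ∈ fccSlots) (hv2 : v 2 = Real.sqrt (2 / 3))
    (hsteep₂ : Real.sqrt 2 / 2 ≤ ⟪L₂ v, -EuclideanSpace.single (2 : Fin 3) (1 : ℝ)⟫_ℝ)
    (hapart₂ : ∀ F ∈ chainFrames (-EuclideanSpace.single (2 : Fin 3) (1 : ℝ)) L₂ v,
      F '' fccStacking 1 (Real.sqrt (2 / 3)) ≠ L₁ '' fccStacking 1 (Real.sqrt (2 / 3)) ∧
      F '' fccStacking 1 (Real.sqrt (2 / 3)) ≠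
        (twinFrame L₁ (L₁ (EuclideanSpace.single (2 : Fin 3) (1 : ℝ)))) '' fccStacking 1 (Real.sqrt (2 / 3)))
    (R₀ : ℝ) (hR₀ : 6 ≤ R₀) :
    ∃ step₂ : ℤ → EuclideanSpace ℝ (Fin 3),
      (∀ k, IsUpBond L₂ σ₂ (-EuclideanSpace.single (2 : Fin 3) (1 : ℝ)) k (step₂ k)) ∧
      (∀ k, σ₂ k = 1 → step₂ k = v) ∧
      (∀ k, σ₂ k = -1 → ⟪step₂ k, L₂.symm (-EuclideanSpace.single (2 : Fin 3) (1 : ℝ))⟫_ℝ =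
        bilayerRise L₂ σ₂ (-EuclideanSpace.single (2 : Fin 3) (1 : ℝ)) k) ∧
      ∀ h : ℝ, 0 ≤ h → ∀ ρ : ℝ, R₀ ≤ ρ → ∀ X P₁ P₂ : Finset (EuclideanSpace ℝ (Fin 3)),
      (∀ p ∈ X, ∀ q ∈ X, p ≠ q → 1 ≤ dist p q) → P₁ ⊆ X → P₂ ⊆ X \ P₁ → (∀ p ∈ X, p ∈ cyl R₀ h ρ) →
      (∀ p, p ∈ P₁ ↔ (p ∈ stacking L₁ s₁ σ₁ ∧ -(2 * R₀) ≤ p 2 ∧ p 2 ≤ -R₀ ∧ p 0 ^ 2 + p 1 ^ 2 ≤ ρ ^ 2)) →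
      (∀ p, p ∈ P₂ ↔ (p ∈ stacking L₂ s₂ σ₂ ∧ h + R₀ ≤ p 2 ∧ p 2 ≤ h + 2 * R₀ ∧ p 0 ^ 2 + p 1 ^ 2 ≤ ρ ^ 2)) →
      ∃ (m : ℝ) (T₂ : Finset (Fin 2 → ℤ)), 0 ≤ m ∧
        (∀ t : Fin 2 → ℤ, (∃ k : ℤ,
          h + R₀ + 3 ≤ (L₂ (zigVertexS step₂ k + ((t 0 : ℝ) • triangularVec₁ 1 + (t 1 : ℝ) • triangularVec₂ 1)) + s₂) 2 ∧
          (L₂ (zigVertexS step₂ k + ((t 0 : ℝ) • triangularVec₁ 1 + (t 1 : ℝ) • triangularVec₂ 1)) + s₂) 2 ≤ h + R₀ + 4 ∧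
          Real.sqrt ((L₂ (zigVertexS step₂ k + ((t 0 : ℝ) • triangularVec₁ 1 + (t 1 : ℝ) • triangularVec₂ 1)) + s₂) 0 ^ 2 +
            (L₂ (zigVertexS step₂ k + ((t 0 : ℝ) • triangularVec₁ 1 + (t 1 : ℝ) • triangularVec₂ 1)) + s₂) 1 ^ 2) ≤ ρ - m) →
          t ∈ T₂) ∧
        (T₂.card : ℝ) + 18 * m * ρ ≤
          (∑ y ∈ X.filter (fun y => (X.filter fun q => dist y q = 1).card ≠ 12 ∧ -R₀ - 2 ≤ y 2 ∧ y 2 ≤ h + R₀ + 2),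
            ((12 : ℝ) - ((X.filter fun q => dist y q = 1).card : ℝ))) + (318 + 192 * R₀) * (1 + h) * ρ := by
  set e₃ : EuclideanSpace ℝ (Fin 3) := EuclideanSpace.single (2 : Fin 3) (1 : ℝ) with he₃
  have he₃n : ‖e₃‖ = 1 := by rw [he₃, PiLp.norm_single, norm_one]
  have hztn : ‖-e₃‖ = 1 := by rw [norm_neg, he₃n]
  -- the ∇ slot, machine steps, canonical states
  set G₂ := twinFrame L₂ (L₂ e₃) with hG₂
  set q₂ := bestCapper G₂ (L₂ e₃) (-e₃) with hq₂
  set ms₂ : ℤ → EuclideanSpace ℝ (Fin 3) := fun m => if σ₂ m = 1 then v else basalMirror q₂ with hms₂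
  set canon₂ : ℤ → EuclideanSpace ℝ (Fin 3) → EuclideanSpace ℝ (Fin 3) × List WalkEntry :=
    fun m t => if σ₂ (m - 1) = 1 then (t, [⟨L₂, v, 0⟩]) else (t, [⟨G₂, q₂, L₂ e₃⟩, ⟨L₂, v, 0⟩]) with hcanon₂
  have hne : ¬ ((-1 : ℤ) = 1) := by decide
  have hms₂₁ : ∀ m, σ₂ m = 1 → ms₂ m = v := fun m hm => by simp only [hms₂, hm, if_true]
  have hms₂₂ : ∀ m, σ₂ m = -1 → ms₂ m = basalMirror q₂ := fun m hm => by simp only [hms₂, hm, hne, if_false]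
  have hcanon₂₁ : ∀ m t, σ₂ (m - 1) = 1 → canon₂ m t = (t, [⟨L₂, v, 0⟩]) := fun m t hm => by simp only [hcanon₂, hm, if_true]
  have hcanon₂₂ : ∀ m t, σ₂ (m - 1) = -1 → canon₂ m t = (t, [⟨G₂, q₂, L₂ e₃⟩, ⟨L₂, v, 0⟩]) := fun m t hm => by
    simp only [hcanon₂, hm, hne, if_false]
  have hup : ∀ k, IsUpBond L₂ σ₂ (-e₃) k (ms₂ k) := isUpBond_machineStep_at σ₂ L₂ (-e₃) v ms₂ hσ₂ hax₂ hv hv2 hms₂₁ hms₂₂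
  have hrise : ∀ k, σ₂ k = -1 → ⟪ms₂ k, L₂.symm (-e₃)⟫_ℝ = bilayerRise L₂ σ₂ (-e₃) k := by
    intro k hk
    rw [hms₂₂ k hk]
    exact inner_basalMirror_bestCapper σ₂ L₂ (-e₃) hax₂ k hk
  refine ⟨ms₂, hup, hms₂₁, hrise, ?_⟩
  intro h hh ρ hρ X P₁ P₂ hX hP₁X hP₂X' hcyl hP₁ hP₂
  have hP₂X : P₂ ⊆ X := hP₂X'.trans Finset.sdiff_subset
  have hcell : ∀ p ∈ X, -(2 * R₀) ≤ p 2 ∧ p 2 ≤ h + 2 * R₀ ∧ p 0 ^ 2 + p 1 ^ 2 ≤ ρ ^ 2 := fun p hp => by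
    have := hcyl p hp; simpa only [cyl, Set.mem_setOf_eq] using this
  -- rise floor 1/4 on both bilayer signs
  have hs22 : (1 / 4 : ℝ) ≤ Real.sqrt 2 / 2 := by
    have : (1 : ℝ) ≤ Real.sqrt 2 := by
      rw [show (1 : ℝ) = Real.sqrt 1 by rw [Real.sqrt_one]]
      exact Real.sqrt_le_sqrt (by norm_num)
    linarith
  have hδ₂ : ∀ m, (1 / 4 : ℝ) ≤ ⟪L₂ (ms₂ m), -e₃⟫_ℝ := by
    intro m
    rcases hσ₂ m with hm | hm
    · rw [hms₂₁ m hm]; exact hs22.trans hsteep₂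
    · rw [inner_map_eq_inner_symm, hrise m hm]; exact quarter_le_bilayerRise L₂ σ₂ hztn m
  -- the polyline
  have hsucc₂ : ∀ k, zigVertexS ms₂ (k + 1) = zigVertexS ms₂ k + ms₂ k := fun k => zigVertexS_succ ms₂ k
  have hlayer₂ : ∀ k, zigVertexS ms₂ k ∈ barlowLayer 1 (Real.sqrt (2 / 3)) σ₂ k :=
    zigVertexS_mem_barlowLayer_of_upBond L₂ hσ₂ (-e₃) hax₂ hup
  -- the line count with explicit margin
  have hq : (1 : ℝ) / 4 > 0 := by norm_num
  obtain ⟨T₂, hT₂, hcount⟩ := barlow_lineCount_le_payers_oneSided_top hX hsE hcert hDS hCP hσ₁ hσ₂ L₁ L₂ s₁ s₂ R₀ h ρ hR₀ hh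
    (by linarith) P₁ P₂ hP₁X hP₂X hcell hP₁ hP₂ v canon₂ ms₂ hv hv2 hsteep₂ hcanon₂₁ hcanon₂₂ hms₂₁ hms₂₂ hq hδ₂ hapart₂
    (zigVertexS ms₂) hsucc₂ hlayer₂
  set m : ℝ := 3 + 8 / 3 * (h + 4 * R₀) + 3 / (1 / 4) with hm
  have hmval : m = 15 + 8 / 3 * h + 32 / 3 * R₀ := by rw [hm]; ring
  have hm0 : 0 ≤ m := by rw [hmval]; nlinarith
  have hρ0 : 0 ≤ ρ := by linarith
  refine ⟨m, T₂, hm0, hT₂, ?_⟩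
  have hpen : 18 * m * ρ ≤ (318 + 192 * R₀) * (1 + h) * ρ := by
    rw [hmval]
    have h1 : 18 * (15 + 8 / 3 * h + 32 / 3 * R₀) ≤ (318 + 192 * R₀) * (1 + h) := by nlinarith
    exact mul_le_mul_of_nonneg_right h1 hρ0
  linarith

end Summit.Ventures.Crystal3D.Theorems

end
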